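import Summits.AtomisticToContinuum.Crystallization.Theorems.FrustratedLawDichotomyStrainedPatchHomCurvDispatch2
import Summits.AtomisticToContinuum.Crystallization.Theorems.FrustratedLawDichotomyStrainedPatchHomCurvLeafSmoke

/-!
# The curvature and slope leaves of lever (C) with the RADIUS-SAFE dispatcher (`coeffFI2`), and a 360-label kernel test

decomp-a2c hand-1 g26 (crux `AperiodicFrustratedLawGap`, stmt-AtomisticToContinuum-27623; `λ`-leaf of lever (C)).  `…HomCurvLeaf.curvCheck` /
`…HomSlopeLeaf.slopeCheck` are sound but, through `FI.sqrt`, numerically useless for labels with `ρ ≥ 4` (`…HomCurvDispatch2` docstring).  This file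
repeats the two leaves over `coeffFI2` (identical soundness statements: the `hcurv` and `hG` inputs of `…HomConvexSegmentW45.hcpShifted_floor_W45`)
and adds the in-kernel label enumeration + a kernel test on ALL B-labels within `4.7` of the centre (360 labels, the production label set of a leaf):

* §1–§2 `curvCheck2` + ★★★ `curv_floor_of_curvCheck2`;  §3 `slopeCheck2` + ★★★ `slope_bound_of_slopeCheck2`;
* §4 `boxLabels7`, `nearLabels` (kernel filter on the squared-radius enclosure), kernel tests.

Kernel definitions + soundness; 0 sorry; standard axioms; no instances / notation / `#eval`.  `--supports stmt-AtomisticToContinuum-27623`.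
-/

noncomputable section

namespace Summit.AtomisticToContinuum.Crystallization.Theorems.FrustratedLawDichotomyStrainedPatchHomCurvLeaf

open scoped BigOperators RealInnerProductSpace
open Literature.Analysis.ValidatedNumerics.Numerics
open Summit.AtomisticToContinuum.Crystallization.Theorems.ChargedEnergyGapNegative (E3)
open Summit.AtomisticToContinuum.Crystallization.Theorems.FrustratedLawDichotomySchurCut (effPot w₄₅ ω₄)
open Summit.AtomisticToContinuum.Crystallization.Theorems.FrustratedLawDichotomyStrainedPatchHomSplit (latPt hexFrame hcpShift)
open Summit.AtomisticToContinuum.Crystallization.Theorems.FrustratedLawDichotomyStrainedPatchHomEntryGram (entryFI mem_entryFI)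
open Summit.AtomisticToContinuum.Crystallization.Theorems.FrustratedLawDichotomyStrainedPatchHomEntryGramHcp (dot3 shufFI mem_dot3 mem_shufFI)
open Summit.AtomisticToContinuum.Crystallization.Theorems.FrustratedLawDichotomyStrainedPatchHomForceKit (vecB mem_vecB)
open Summit.AtomisticToContinuum.Crystallization.Theorems.FrustratedLawDichotomyStrainedPatchHomCurvCoeff (coeffFI2 mem_coeffFI2 mem_coeffFI2_beta)
open Summit.AtomisticToContinuum.Crystallization.Theorems.FrustratedLawDichotomyStrainedPatchHomCurvKit
  (accFI mem_accFI hessEntryFI domTest curvatureSum_ge_of_domTest)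
open Summit.AtomisticToContinuum.Crystallization.Theorems.FrustratedLawDichotomyStrainedPatchHomConvexCurvature (segGd_eq_rankOne slopeSum_abs_le_of_enclosure)
open Summit.AtomisticToContinuum.Crystallization.Theorems.FrustratedLawDichotomyStrainedPatchTaylorChord (segR segG segGd)
open Summit.AtomisticToContinuum.Crystallization.Theorems.FrustratedLawDichotomyStrainedPatchTaylorLeaves (junctions)
open Summit.AtomisticToContinuum.Crystallization.Theorems.FrustratedLawDichotomyStrainedPatchHomLatticeBoxHcp (norm_shifted_gt)

/-! ## §1. The Boolean -/

/-- ★ **CURVATURE CHECK** over the twelve-coordinate box `(c, w)` (`Sum.inl` = entries of `U`, `Sum.inr` = shuffle), label list `L`, floor `lamS/SC`: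
all per-label coefficient enclosures succeed and the Hessian-entry accumulator passes the dominance test. -/
def curvCheck2 (c w : (Fin 3 × Fin 3) ⊕ Fin 3 → ℤ) (L : List (Fin 3 → ℤ)) (lamS : ℤ) : Bool :=
  let E := entryFI (fun ab => c (Sum.inl ab)) (fun ab => w (Sum.inl ab))
  let X := shufFI c w
  let C : (Fin 3 → ℤ) → Fin 3 → FI := fun b => vecB E X b
  let K : (Fin 3 → ℤ) → Option (FI × FI) := fun b => coeffFI2 (dot3 (C b) (C b))
  (L.all fun b => (K b).isSome) &&
    domTest (hessEntryFI L (fun b => ((K b).getD (FI.ofInt 0, FI.ofInt 0)).1) (fun b => ((K b).getD (FI.ofInt 0, FI.ofInt 0)).2) C) lamS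

/-! ## §2. Soundness -/

/-- ★★★ **SOUNDNESS OF THE CURVATURE LEAF.**  If `curvCheck2 c w L lamS = true` (`L` duplicate-free) then for every `U` with entries in the box and
`‖U − 1‖ ≤ 1/4`, all shuffles `ξ₀, ξ` in the box with `‖ξ₀‖, ‖ξ‖ ≤ 1/4`, and every `s ∈ (0,1)` at which the radii
`‖latPt U hexFrame b + U(hcpShift + ξ₀) + s·U(ξ − ξ₀)‖`, `b ∈ L`, avoid the junction radii:
`(lamS/SC)·‖U(ξ − ξ₀)‖² ≤ Σ_{b ∈ L.toFinset} segGd (deriv W₄₅) (latPt U hexFrame b + U(hcpShift + ξ₀)) (U(ξ − ξ₀)) s` — the `hcurv` input of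
`…HomConvexSegmentW45.hcpShifted_floor_W45` (`W₄₅ = effPot w₄₅ ω₄ (3/400) = Wrec`). [folklore chaining] -/
theorem curv_floor_of_curvCheck2 {c w : (Fin 3 × Fin 3) ⊕ Fin 3 → ℤ} {L : List (Fin 3 → ℤ)} (hL : L.Nodup) {lamS : ℤ}
    (h : curvCheck2 c w L lamS = true) (U : E3 →L[ℝ] E3) (hU : ‖U - 1‖ ≤ 1 / 4)
    (hbox : ∀ ab : Fin 3 × Fin 3, |(U (EuclideanSpace.single ab.2 (1 : ℝ))) ab.1 - (c (Sum.inl ab) : ℝ) / SC| ≤ (w (Sum.inl ab) : ℝ) / SC)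
    (ξ₀ ξ : E3) (hξ₀ : ∀ i : Fin 3, |ξ₀ i - (c (Sum.inr i) : ℝ) / SC| ≤ (w (Sum.inr i) : ℝ) / SC)
    (hξ : ∀ i : Fin 3, |ξ i - (c (Sum.inr i) : ℝ) / SC| ≤ (w (Sum.inr i) : ℝ) / SC) (hn₀ : ‖ξ₀‖ ≤ 1 / 4) (hn : ‖ξ‖ ≤ 1 / 4)
    {s : ℝ} (hs : s ∈ Set.Ioo (0 : ℝ) 1)
    (hgood : ∀ b ∈ L.toFinset, segR (latPt U hexFrame b + U (hcpShift + ξ₀)) (U (ξ - ξ₀)) s ∉ junctions) :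
    (lamS : ℝ) / SC * ‖U (ξ - ξ₀)‖ ^ 2 ≤
      ∑ b ∈ L.toFinset, segGd (deriv (effPot w₄₅ ω₄ (3 / 400))) (latPt U hexFrame b + U (hcpShift + ξ₀)) (U (ξ - ξ₀)) s := by
  classical
  -- unpack the Boolean
  unfold curvCheck2 at h
  simp only [Bool.and_eq_true, List.all_eq_true] at h
  obtain ⟨hall, hdom⟩ := h
  set E := entryFI (fun ab => c (Sum.inl ab)) (fun ab => w (Sum.inl ab)) with hE
  set X := shufFI c w with hX
  set C : (Fin 3 → ℤ) → Fin 3 → FI := fun b => vecB E X b with hC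
  set K : (Fin 3 → ℤ) → Option (FI × FI) := fun b => coeffFI2 (dot3 (C b) (C b)) with hK
  -- the intermediate shuffle `η = ξ₀ + s(ξ − ξ₀)` is in the box and in the ball
  set η : E3 := ξ₀ + s • (ξ - ξ₀) with hη
  have hηbox : ∀ i : Fin 3, |η i - (c (Sum.inr i) : ℝ) / SC| ≤ (w (Sum.inr i) : ℝ) / SC := by
    intro i
    have : η i = ξ₀ i + s * (ξ i - ξ₀ i) := by simp [hη]
    rw [this]
    exact abs_sub_le_of_segment (hξ₀ i) (hξ i) hs.1.le hs.2.le
  have hηn : ‖η‖ ≤ 1 / 4 := by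
    have hdec : η = (1 - s) • ξ₀ + s • ξ := by
      rw [hη, smul_sub, sub_smul, one_smul]; abel
    rw [hdec]
    calc ‖(1 - s) • ξ₀ + s • ξ‖ ≤ ‖(1 - s) • ξ₀‖ + ‖s • ξ‖ := norm_add_le _ _
      _ = (1 - s) * ‖ξ₀‖ + s * ‖ξ‖ := by
          rw [norm_smul, norm_smul, Real.norm_eq_abs, Real.norm_eq_abs, abs_of_nonneg (by linarith [hs.2]), abs_of_nonneg hs.1.le]
      _ ≤ (1 - s) * (1 / 4) + s * (1 / 4) := by gcongr <;> linarith [hs.1, hs.2]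
      _ = 1 / 4 := by ring
  -- the point on the segment is the `B`-family displacement at shuffle `η`
  have hpt : ∀ b : Fin 3 → ℤ, latPt U hexFrame b + U (hcpShift + ξ₀) + s • U (ξ - ξ₀) = latPt U hexFrame b + U (hcpShift + η) := by
    intro b
    have : U (hcpShift + η) = U (hcpShift + ξ₀) + s • U (ξ - ξ₀) := by
      rw [hη, ← map_smul, ← map_add]; congr 1; abel
    rw [this, add_assoc]
  -- per-label memberships
  have hCmem : ∀ b : Fin 3 → ℤ, ∀ a : Fin 3, FI.mem ((latPt U hexFrame b + U (hcpShift + η)) a) (C b a) :=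
    fun b a => mem_vecB U η (fun ab => mem_entryFI (hbox ab)) (fun i => mem_shufFI (hηbox i)) b a
  have hQmem : ∀ b : Fin 3 → ℤ, FI.mem (‖latPt U hexFrame b + U (hcpShift + η)‖ ^ 2) (dot3 (C b) (C b)) := by
    intro b
    rw [← real_inner_self_eq_norm_sq]
    exact mem_dot3 (hCmem b) (hCmem b)
  have hρpos : ∀ b : Fin 3 → ℤ, 0 < ‖latPt U hexFrame b + U (hcpShift + η)‖ := fun b =>
    lt_trans (by norm_num) (norm_shifted_gt hU hηn b)
  -- `segR` at parameter `s` is that radius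
  have hsegR : ∀ b : Fin 3 → ℤ, segR (latPt U hexFrame b + U (hcpShift + ξ₀)) (U (ξ - ξ₀)) s = ‖latPt U hexFrame b + U (hcpShift + η)‖ := by
    intro b; rw [segR, hpt]
  -- the coefficient enclosures for the labels of `L`
  have hKsome : ∀ b ∈ L, ∃ AB, K b = some AB := fun b hb => Option.isSome_iff_exists.1 (hall b hb)
  have hA : ∀ b ∈ L, FI.mem ((deriv (deriv (effPot w₄₅ ω₄ (3 / 400))) ‖latPt U hexFrame b + U (hcpShift + η)‖ -
      deriv (effPot w₄₅ ω₄ (3 / 400)) ‖latPt U hexFrame b + U (hcpShift + η)‖ / ‖latPt U hexFrame b + U (hcpShift + η)‖) /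
      ‖latPt U hexFrame b + U (hcpShift + η)‖ ^ 2) ((K b).getD (FI.ofInt 0, FI.ofInt 0)).1 := by
    intro b hb
    obtain ⟨AB, hAB⟩ := hKsome b hb
    have hJ : ‖latPt U hexFrame b + U (hcpShift + η)‖ ∉ junctions := by
      rw [← hsegR]; exact hgood b (List.mem_toFinset.2 hb)
    have := (mem_coeffFI2 (hρpos b) hJ (hQmem b) hAB).1
    rw [hAB]; simpa using this
  have hB : ∀ b ∈ L, FI.mem (deriv (effPot w₄₅ ω₄ (3 / 400)) ‖latPt U hexFrame b + U (hcpShift + η)‖ / ‖latPt U hexFrame b + U (hcpShift + η)‖)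
      ((K b).getD (FI.ofInt 0, FI.ofInt 0)).2 := by
    intro b hb
    obtain ⟨AB, hAB⟩ := hKsome b hb
    have hJ : ‖latPt U hexFrame b + U (hcpShift + η)‖ ∉ junctions := by
      rw [← hsegR]; exact hgood b (List.mem_toFinset.2 hb)
    have := (mem_coeffFI2 (hρpos b) hJ (hQmem b) hAB).2
    rw [hAB]; simpa using this
  -- the kernel test ⟹ the rank-one curvature-sum floor
  have key := curvatureSum_ge_of_domTest L hL
    (α := fun b => (deriv (deriv (effPot w₄₅ ω₄ (3 / 400))) ‖latPt U hexFrame b + U (hcpShift + η)‖ -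
      deriv (effPot w₄₅ ω₄ (3 / 400)) ‖latPt U hexFrame b + U (hcpShift + η)‖ / ‖latPt U hexFrame b + U (hcpShift + η)‖) /
      ‖latPt U hexFrame b + U (hcpShift + η)‖ ^ 2)
    (β := fun b => deriv (effPot w₄₅ ω₄ (3 / 400)) ‖latPt U hexFrame b + U (hcpShift + η)‖ / ‖latPt U hexFrame b + U (hcpShift + η)‖)
    (c := fun b => latPt U hexFrame b + U (hcpShift + η)) hA hB (fun b _ a => hCmem b a) hdom (U (ξ - ξ₀))
  refine key.trans (le_of_eq (Finset.sum_congr rfl fun b _ => ?_))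
  -- identify each summand with `segGd` at parameter `s`
  have h0 : segR (latPt U hexFrame b + U (hcpShift + ξ₀)) (U (ξ - ξ₀)) s ≠ 0 := by rw [hsegR]; exact (hρpos b).ne'
  rw [segGd_eq_rankOne _ _ _ h0, hsegR, hpt]


/-! ## §3. The slope Boolean (radius-safe) and its soundness -/

/-- ★ **SLOPE CHECK** over the box `(c, w)`, label list `L`, bound `Gs/SC`: all `coeffFI` succeed and the `ℓ¹` size of the gradient-vector
enclosure `g_i = Σ_b B_b·C_b i` is `≤ Gs`. -/
def slopeCheck2 (c w : (Fin 3 × Fin 3) ⊕ Fin 3 → ℤ) (L : List (Fin 3 → ℤ)) (Gs : ℤ) : Bool :=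
  let E := entryFI (fun ab => c (Sum.inl ab)) (fun ab => w (Sum.inl ab))
  let X := shufFI c w
  let C : (Fin 3 → ℤ) → Fin 3 → FI := fun b => vecB E X b
  let K : (Fin 3 → ℤ) → Option (FI × FI) := fun b => coeffFI2 (dot3 (C b) (C b))
  (L.all fun b => (K b).isSome) &&
    decide ((∑ i : Fin 3, (accFI L fun b => (((K b).getD (FI.ofInt 0, FI.ofInt 0)).2).mul (C b i)).absHi) ≤ Gs)

/-- ★★★ **SOUNDNESS OF THE SLOPE LEAF.**  If `slopeCheck2 c w L Gs = true` (`L` duplicate-free) then for every `U` with entries in the box and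
`‖U − 1‖ ≤ 1/4`, every shuffle `ξ₀` in the box with `‖ξ₀‖ ≤ 1/4` and every `ξ`:
`|Σ_{b ∈ L.toFinset} segG (deriv W₄₅) (latPt U hexFrame b + U(hcpShift + ξ₀)) (U(ξ − ξ₀)) 0| ≤ (Gs/SC)·‖U(ξ − ξ₀)‖` — the `hG` input of
`…HomConvexSegmentW45.hcpShifted_floor_W45`. [folklore chaining] -/
theorem slope_bound_of_slopeCheck2 {c w : (Fin 3 × Fin 3) ⊕ Fin 3 → ℤ} {L : List (Fin 3 → ℤ)} (hL : L.Nodup) {Gs : ℤ}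
    (h : slopeCheck2 c w L Gs = true) (U : E3 →L[ℝ] E3) (hU : ‖U - 1‖ ≤ 1 / 4)
    (hbox : ∀ ab : Fin 3 × Fin 3, |(U (EuclideanSpace.single ab.2 (1 : ℝ))) ab.1 - (c (Sum.inl ab) : ℝ) / SC| ≤ (w (Sum.inl ab) : ℝ) / SC)
    (ξ₀ : E3) (hξ₀ : ∀ i : Fin 3, |ξ₀ i - (c (Sum.inr i) : ℝ) / SC| ≤ (w (Sum.inr i) : ℝ) / SC) (hn₀ : ‖ξ₀‖ ≤ 1 / 4) (ξ : E3) :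
    |∑ b ∈ L.toFinset, segG (deriv (effPot w₄₅ ω₄ (3 / 400))) (latPt U hexFrame b + U (hcpShift + ξ₀)) (U (ξ - ξ₀)) 0| ≤
      (Gs : ℝ) / SC * ‖U (ξ - ξ₀)‖ := by
  classical
  have hS : (0 : ℝ) < SC := by norm_num [SC]
  unfold slopeCheck2 at h
  simp only [Bool.and_eq_true, List.all_eq_true, decide_eq_true_eq] at h
  obtain ⟨hall, hsum⟩ := h
  set E := entryFI (fun ab => c (Sum.inl ab)) (fun ab => w (Sum.inl ab)) with hE
  set X := shufFI c w with hX
  set C : (Fin 3 → ℤ) → Fin 3 → FI := fun b => vecB E X b with hC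
  set K : (Fin 3 → ℤ) → Option (FI × FI) := fun b => coeffFI2 (dot3 (C b) (C b)) with hK
  set g : Fin 3 → FI := fun i => accFI L fun b => (((K b).getD (FI.ofInt 0, FI.ofInt 0)).2).mul (C b i) with hg
  -- per-label memberships at the base point
  have hCmem : ∀ b : Fin 3 → ℤ, ∀ a : Fin 3, FI.mem ((latPt U hexFrame b + U (hcpShift + ξ₀)) a) (C b a) :=
    fun b a => mem_vecB U ξ₀ (fun ab => mem_entryFI (hbox ab)) (fun i => mem_shufFI (hξ₀ i)) b a
  have hQmem : ∀ b : Fin 3 → ℤ, FI.mem (‖latPt U hexFrame b + U (hcpShift + ξ₀)‖ ^ 2) (dot3 (C b) (C b)) := by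
    intro b; rw [← real_inner_self_eq_norm_sq]; exact mem_dot3 (hCmem b) (hCmem b)
  have hρpos : ∀ b : Fin 3 → ℤ, 0 < ‖latPt U hexFrame b + U (hcpShift + ξ₀)‖ := fun b =>
    lt_trans (by norm_num) (norm_shifted_gt hU hn₀ b)
  have hB : ∀ b ∈ L, FI.mem (deriv (effPot w₄₅ ω₄ (3 / 400)) ‖latPt U hexFrame b + U (hcpShift + ξ₀)‖ / ‖latPt U hexFrame b + U (hcpShift + ξ₀)‖)
      ((K b).getD (FI.ofInt 0, FI.ofInt 0)).2 := by
    have hKsome : ∀ b ∈ L, ∃ AB, K b = some AB := fun b hb => Option.isSome_iff_exists.1 (hall b hb)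
    intro b hb
    obtain ⟨AB, hAB⟩ := hKsome b hb
    have := mem_coeffFI2_beta (hρpos b) (hQmem b) hAB
    rw [hAB]; simpa using this
  -- the gradient coordinates are enclosed by `g`
  have hgmem : ∀ i : Fin 3, FI.mem (∑ b ∈ L.toFinset, deriv (effPot w₄₅ ω₄ (3 / 400)) ‖latPt U hexFrame b + U (hcpShift + ξ₀)‖ /
      ‖latPt U hexFrame b + U (hcpShift + ξ₀)‖ * (latPt U hexFrame b + U (hcpShift + ξ₀)) i) (g i) :=
    fun i => mem_accFI L hL fun b hb => FI.mem_mul (hB b hb) (hCmem b i)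
  -- conclude with the ℓ¹ slope lemma
  refine slopeSum_abs_le_of_enclosure L.toFinset (deriv (effPot w₄₅ ω₄ (3 / 400))) (fun b => latPt U hexFrame b + U (hcpShift + ξ₀))
    (fun i => ((g i).lo : ℝ) / SC) (fun i => ((g i).hi : ℝ) / SC) (fun i => FI.lo_div_le (hgmem i)) (fun i => FI.le_hi_div (hgmem i)) ?_ (U (ξ - ξ₀))
  -- `Σ_i max |lo| |hi| = (Σ_i absHi)/SC ≤ Gs/SC`
  have hterm : ∀ i : Fin 3, max |((g i).lo : ℝ) / SC| |((g i).hi : ℝ) / SC| = ((g i).absHi : ℝ) / SC := by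
    intro i
    rw [FI.absHi, Int.cast_max, Int.cast_abs, Int.cast_abs, abs_div, abs_div, abs_of_pos hS, max_div_div_right hS.le]
  simp only [hterm, ← Finset.sum_div]
  have hcast : ((∑ i : Fin 3, (g i).absHi : ℤ) : ℝ) ≤ (Gs : ℝ) := by exact_mod_cast hsum
  push_cast at hcast
  exact div_le_div_of_nonneg_right hcast hS.le


/-! ## §4. In-kernel label enumeration and kernel tests -/

/-- The coordinate range `[−7, 7]`. -/
def rng15 : List ℤ := (List.range 15).map fun i => (i : ℤ) - 7

/-- All labels of the box `[−7, 7]³` (the hcp B-family index box of the `(H)` certificate). -/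
def boxLabels7 : List (Fin 3 → ℤ) :=
  rng15.flatMap fun i => rng15.flatMap fun j => rng15.map fun k => ![i, j, k]

/-- Near labels of a box: those whose squared-radius enclosure can go below `r2n/r2d` (the others have `W₄₅′ = W₄₅″ = 0` once `r2n/r2d ≥ (9/2)²`). -/
def nearLabels (c w : (Fin 3 × Fin 3) ⊕ Fin 3 → ℤ) (r2n : ℤ) (r2d : ℕ) : List (Fin 3 → ℤ) :=
  let E := entryFI (fun ab => c (Sum.inl ab)) (fun ab => w (Sum.inl ab))
  let X := shufFI c w
  boxLabels7.filter fun b => decide ((dot3 (vecB E X b) (vecB E X b)).lo < (FI.ofFrac r2n r2d).hi)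

/-- KERNEL TEST: 360 B-labels within `4.7` of the centre of the smoke box (`U ≈ 0.97128·1 ± 2⁻¹¹`, `ξ ∈ 0 ± 2⁻¹¹`). -/
theorem nearLabels_smoke_length : (nearLabels cSmoke wSmoke 2209 100).length = 360 := by decide +kernel

/-- ★ KERNEL TEST: the radius-safe curvature leaf on the FULL near-label set at floor `λ = 2`. -/
theorem curvCheck2_smoke : curvCheck2 cSmoke wSmoke (nearLabels cSmoke wSmoke 2209 100) (2 * 281474976710656) = true := by
  decide +kernel

end Summit.AtomisticToContinuum.Crystallization.Theorems.FrustratedLawDichotomyStrainedPatchHomCurvLeaf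

end
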